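import Summits.ValiantsHypothesis.ValiantsHypothesis.Theorems.MonotoneRestorationOrbitRestorationQPWideSymSupport
import Summits.ValiantsHypothesis.ValiantsHypothesis.Theorems.MonotoneRestorationOrbitRestorationQPSupportForm
import Summits.ValiantsHypothesis.ValiantsHypothesis.Theorems.MonotoneRestorationOrbitRestorationQPBlockProducts
import HarnessLib

/-!
# The crux in BLOCK currency: `OrbitRestorationQP` ⟺ wide derivations with polylog rigid supports on all values AND all operand
# multisets (ORBIT currency, XXII)

Route MonotoneRestoration, crux `OrbitRestorationQP` (stmt-ValiantsHypothesis-18293), namespace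
`Summit.ValiantsHypothesis.ValiantsHypothesis.Theorems.ValueSymSupport` (continued).

The wide form of the crux (`ValueOrbit.orbitRestorationQP_iff_wideOrbitQP`: sums free, a product costs the orbit of its operand
multiset) is restated in the currency of the block criterion `BlockProducts.qpOrbitRestorable_of_blocks`: supports instead of orbits.
`rigid_everywhere_polylog`: a wide derivation of orbit width `≤ 2^((log₂ n + c)^c)` has every value fixed, and every product step's
operand multiset permuted exactly, by the pointwise stabiliser of at most `(log₂ n + c + 4)^(c+4)` indices (all `n`; small `n` by the
trivial support).  Conversely supports of size `s` give orbit width `≤ (n+1)^s` (`ValueOrbit.orbit_bounded_of_supported`,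
`BlockProducts.ncard_range_map_le_of_perm`).  Hence (`orbitRestorationQP_iff_wideSupportQP`):

  `OrbitRestorationQP ⟺` every matrix-symmetric `VP` family has, for one `c` and all `n`, a wide derivation of `f n` in which every
  value is fixed, and every product's operand multiset is permuted exactly, by the pointwise stabiliser of `≤ (log₂ n + c)^c` indices.

So the hypotheses of the block criterion are not a special design but the general shape of every restoring computation.  Neither side
is claimed; everything here is proved. [folklore]

## References
* A. Dawar, G. Wilsenach, *Symmetric arithmetic circuits*, ToC 21 (2025), Def. 6.1, Thm 6.3. [DawarWilsenach2025]
-/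

noncomputable section

open scoped Classical

-- `Summit.ValiantsHypothesis.ValiantsHypothesis.…` is the tree's single-conjunct layout (Sub = Summit).
set_option linter.dupNamespace false

namespace Summit.ValiantsHypothesis.ValiantsHypothesis.Theorems

namespace ValueSymSupport

open Equiv Literature.Computability.AlgebraicComplexity

variable {n : ℕ}

/-- **Rigid supports everywhere, at quasi-polynomial scale.**  A wide derivation of orbit width `≤ 2^((log₂ n + c)^c)` has every
value fixed by the pointwise stabiliser of at most `(log₂ n + c + 4)^(c+4)` indices, and every product step's operand multiset
permuted exactly by such a stabiliser. [folklore; cite: DawarWilsenach2025, Def. 6.1] -/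
theorem rigid_everywhere_polylog (c : ℕ) (𝒲 : WideDerivation ℂ (Fin n × Fin n))
    (hW : 𝒲.OrbitWidthLE (Perm (Fin n)) (2 ^ ((Nat.log 2 n + c) ^ c))) :
    ∀ q ∈ 𝒲.S,
      (∃ X : Finset (Fin n), X.card ≤ (Nat.log 2 n + (c + 4)) ^ (c + 4) ∧
        ∀ ρ : Perm (Fin n), (∀ x ∈ X, ρ x = x) → ren ρ q = q) ∧
      ∃ d : WStep ℂ (Fin n × Fin n), d.Valid 𝒲.S 𝒲.rank q ∧
        ∀ M, d = WStep.prod M →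
          ∃ X : Finset (Fin n), X.card ≤ (Nat.log 2 n + (c + 4)) ^ (c + 4) ∧
            ∀ ρ : Perm (Fin n), (∀ x ∈ X, ρ x = x) → M.map (ren ρ) = M := by
  set K := (Nat.log 2 n + c) ^ c with hK
  have hK1 : 1 ≤ K := by
    rcases Nat.eq_zero_or_pos c with rfl | hc
    · simp [hK]
    · exact Nat.one_le_pow _ _ (by omega)
  have habs := pow_polylog_absorb (Nat.log 2 n) c
  intro q hq
  by_cases h : 8 < n ∧ 4 * (K + 3) ≤ n
  · have hB : 2 ^ K < n.choose (K + 3) :=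
      calc 2 ^ K < 2 ^ (K + 3) := Nat.pow_lt_pow_right (by norm_num) (by omega)
        _ ≤ n.choose (K + 3) := two_pow_le_choose n (K + 3) h.2
    obtain ⟨⟨X, hXk, hX⟩, d, hd, hdM⟩ := rigid_everywhere h.1 (by omega) h.2 𝒲 hW hB q hq
    refine ⟨⟨X, by omega, hX⟩, d, hd, fun M hM => ?_⟩
    obtain ⟨Y, hYk, hY⟩ := hdM M hM
    exact ⟨Y, by omega, hY⟩
  · have hcard : (Finset.univ : Finset (Fin n)).card ≤ (Nat.log 2 n + (c + 4)) ^ (c + 4) := by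
      rw [Finset.card_univ, Fintype.card_fin]; omega
    have htriv : ∀ ρ : Perm (Fin n), (∀ x ∈ (Finset.univ : Finset (Fin n)), ρ x = x) → ρ = 1 :=
      fun ρ hρ => Equiv.ext fun x => hρ x (Finset.mem_univ x)
    obtain ⟨-, d, hd, -⟩ := hW q hq
    refine ⟨⟨Finset.univ, hcard, fun ρ hρ => by rw [htriv ρ hρ, ren_one]⟩, d, hd, fun M _ => ?_⟩
    exact ⟨Finset.univ, hcard, fun ρ hρ => by rw [htriv ρ hρ, multiset_map_ren_one]⟩

/-- **`OrbitRestorationQP` ⟺ POLYLOG RIGID SUPPORTS ON VALUES AND OPERAND MULTISETS.**  The crux holds iff every matrix-symmetric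
`VP` family has, for one constant `c` and every `n`, a wide derivation of `f n` (weighted sums and products of any fan-in, any length)
in which every value is fixed, and the operand multiset of every product step is permuted exactly, by the pointwise stabiliser of at
most `(log₂ n + c)^c` indices — the hypotheses of `BlockProducts.qpOrbitRestorable_of_blocks` as the general form of a restoring
computation.  Neither side is claimed. [folklore; cite: DawarWilsenach2025, Thm 6.3] -/
theorem orbitRestorationQP_iff_wideSupportQP :
    Theses.MonotoneRestoration.OrbitRestorationQP ↔
    ∀ f : (n : ℕ) → MvPolynomial (Fin n × Fin n) ℂ,
      (∀ (n : ℕ) (σ τ : Equiv.Perm (Fin n)),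
        MvPolynomial.rename (fun p : Fin n × Fin n => (σ p.1, τ p.2)) (f n) = f n) →
      IsVPFamily f →
      ∃ c : ℕ, ∀ n : ℕ, ∃ 𝒲 : WideDerivation ℂ (Fin n × Fin n), f n ∈ 𝒲.S ∧
        ∀ q ∈ 𝒲.S,
          (∃ X : Finset (Fin n), X.card ≤ (Nat.log 2 n + c) ^ c ∧
            ∀ ρ : Equiv.Perm (Fin n), (∀ x ∈ X, ρ x = x) → ren ρ q = q) ∧
          ∃ d : WStep ℂ (Fin n × Fin n), d.Valid 𝒲.S 𝒲.rank q ∧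
            ∀ M, d = WStep.prod M →
              ∃ X : Finset (Fin n), X.card ≤ (Nat.log 2 n + c) ^ c ∧
                ∀ ρ : Equiv.Perm (Fin n), (∀ x ∈ X, ρ x = x) → M.map (ren ρ) = M := by
  rw [ValueOrbit.orbitRestorationQP_iff_wideOrbitQP]
  constructor
  · intro h f hsymm hVP
    obtain ⟨c, hc⟩ := h f hsymm hVP
    refine ⟨c + 4, fun n => ?_⟩
    obtain ⟨𝒲, hf, hW⟩ := hc n
    exact ⟨𝒲, hf, rigid_everywhere_polylog c 𝒲 hW⟩
  · intro h f hsymm hVP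
    obtain ⟨c, hc⟩ := h f hsymm hVP
    refine ⟨c + 1, fun n => ?_⟩
    obtain ⟨𝒲, hf, hS⟩ := hc n
    refine ⟨𝒲, hf, ValueOrbit.orbitWidthLE_mono (succ_pow_polylog_le n c) fun q hq => ?_⟩
    obtain ⟨⟨X, hXk, hX⟩, d, hd, hdM⟩ := hS q hq
    refine ⟨?_, d, hd, fun M hM => ?_⟩
    · calc (Set.range fun σ : Perm (Fin n) => ren σ q).ncard ≤ (n + 1) ^ X.card :=
            ValueOrbit.orbit_bounded_of_supported hX
        _ ≤ (n + 1) ^ ((Nat.log 2 n + c) ^ c) := Nat.pow_le_pow_right (Nat.succ_pos n) hXk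
    · obtain ⟨Y, hYk, hY⟩ := hdM M hM
      calc (Set.range fun σ : Perm (Fin n) => M.map (ren σ)).ncard ≤ (n + 1) ^ Y.card :=
            BlockProducts.ncard_range_map_le_of_perm hY
        _ ≤ (n + 1) ^ ((Nat.log 2 n + c) ^ c) := Nat.pow_le_pow_right (Nat.succ_pos n) hYk

end ValueSymSupport

end Summit.ValiantsHypothesis.ValiantsHypothesis.Theorems

end
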